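import Mathlib
import Literature.NumberTheory.LFunctions.LiouvilleCharSumLinnikBox

/-!
# (★) One-point transfer for the dilated table Chowla crux (line `positivity-quarantine`)

Stub `stub_onePointTransfer` of the crux `DilatedTableChowla`
(`Summit.Parity.GeneralizedHardyLittlewood.Theses.LiouvilleShiftedTables`), line
positivity-quarantine: a zero-free Linnik box for ALL characters to the moduli `n`, `q ∣ n`,
`n ≤ q (log x)^κ` (`q ≤ x^{1/24}`) yields `(log x)^B`-saving character sums of the Liouville
function to those moduli on the scales `x^{1/2} ≤ y ≤ x²`. This is the tree's
`Literature.NumberTheory.LFunctions.LiouvilleCharSumLinnikBox.norm_sum_le` (Perron + contour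
shift with `1/L` controlled by Borel–Carathéodory in the box, `λ = 𝟙_□ ⋆ μ`, and the prime number
theorem for `λ` for the principal character), applied at the modulus `n ≤ q (log x)^κ ≤ x^{1/16}`.
-/

namespace Summit.Parity.GeneralizedHardyLittlewood.Theorems.DilatedTableChowla.OnePointTransfer

/-- `q (log x)^κ ≤ x^{1/16}` for `q ≤ x^{1/24}` and `x ≥ exp(exp(192κ + 4))`. [folklore] -/
theorem modulus_le {κ x : ℝ} {q : ℕ} (hκ : 0 < κ) (hx : Real.exp (Real.exp (192 * κ + 4)) ≤ x)
    (hq : (q : ℝ) ≤ x ^ (1 / 24 : ℝ)) {n : ℕ} (hn : (n : ℝ) ≤ q * Real.log x ^ κ) :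
    (n : ℝ) ≤ x ^ (1 / 16 : ℝ) := by
  have hx0 : 0 < x := (Real.exp_pos _).trans_le hx
  set L := Real.log x with hL
  have hLℓ : Real.exp (192 * κ + 4) ≤ L := by
    rw [hL, ← Real.log_exp (Real.exp _)]; exact Real.log_le_log (Real.exp_pos _) hx
  have hL0 : 0 < L := (Real.exp_pos _).trans_le hLℓ
  set ℓ := Real.log L with hℓdef
  have hℓ : 192 * κ + 4 ≤ ℓ := by
    rw [hℓdef, ← Real.log_exp (192 * κ + 4)]; exact Real.log_le_log (Real.exp_pos _) hLℓ
  have hLexp : L = Real.exp ℓ := by rw [hℓdef, Real.exp_log hL0]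
  have hLsq : ℓ ^ 2 / 4 ≤ L := by
    have h := Real.add_one_le_exp (ℓ / 2)
    have h2 : Real.exp ℓ = Real.exp (ℓ / 2) * Real.exp (ℓ / 2) := by
      rw [← Real.exp_add]; ring_nf
    rw [hLexp, h2]; nlinarith [Real.exp_pos (ℓ / 2)]
  have hκℓ : κ * ℓ ≤ L / 48 := by nlinarith
  have h1 : L ^ κ ≤ x ^ (1 / 48 : ℝ) := by
    rw [Real.rpow_def_of_pos hL0, Real.rpow_def_of_pos hx0, ← hℓdef, ← hL]
    exact Real.exp_le_exp.2 (by linarith)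
  have h2 : x ^ (1 / 24 : ℝ) * x ^ (1 / 48 : ℝ) = x ^ (1 / 16 : ℝ) := by
    rw [← Real.rpow_add hx0]; norm_num
  calc (n : ℝ) ≤ q * L ^ κ := hn
    _ ≤ x ^ (1 / 24 : ℝ) * x ^ (1 / 48 : ℝ) :=
        mul_le_mul hq h1 (Real.rpow_nonneg hL0.le _) (Real.rpow_nonneg hx0.le _)
    _ = x ^ (1 / 16 : ℝ) := h2

/-- **(★) One-point transfer.** For all `B` and `κ > 0` there are `K', H, x₀` such that for
`x ≥ x₀` and `1 ≤ q ≤ x^{1/24}`: if every `L(s, χ)`, `χ` mod `n`, `q ∣ n ≤ q (log x)^κ`, has no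
zero `s ≠ 1` with `Re s > 1 − K' log log x / log x`, `|Im s| ≤ (log x)^H`, then
`‖∑_{k ≤ y} λ(k) χ(k)‖ ≤ y/(log x)^B` for all such `n`, `χ` and `x^{1/2} ≤ y ≤ x²`.
Proof: `Literature.NumberTheory.LFunctions.LiouvilleCharSumLinnikBox.norm_sum_le` at the modulus
`n ≤ x^{1/16}`. [cite: IwaniecKowalski2004, §18.2] -/
theorem stub_onePointTransfer :
    ∀ B κ : ℝ, 0 < κ → ∃ K' H x₀ : ℝ, ∀ x : ℝ, x₀ ≤ x →
      ∀ q : ℕ, 1 ≤ q → (q : ℝ) ≤ x ^ (1 / 24 : ℝ) →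
        (∀ (n : ℕ) [NeZero n] (χ : DirichletCharacter ℂ n) (z : ℂ), q ∣ n →
            (n : ℝ) ≤ q * Real.log x ^ κ → 1 - K' * Real.log (Real.log x) / Real.log x < z.re →
              |z.im| ≤ Real.log x ^ H → z ≠ 1 → DirichletCharacter.LFunction χ z ≠ 0) →
        ∀ (n : ℕ) [NeZero n] (χ : DirichletCharacter ℂ n) (y : ℝ), q ∣ n →
          (n : ℝ) ≤ q * Real.log x ^ κ → x ^ (1 / 2 : ℝ) ≤ y → y ≤ x ^ 2 →
            ‖∑ k ∈ Finset.Icc 1 ⌊y⌋₊, (ArithmeticFunction.liouville k : ℂ) * χ (k : ZMod n)‖ ≤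
              y / Real.log x ^ B := by
  intro B κ hκ
  obtain ⟨K', H, x₀, h⟩ := Literature.NumberTheory.LFunctions.LiouvilleCharSumLinnikBox.norm_sum_le B
  refine ⟨K', H, max x₀ (Real.exp (Real.exp (192 * κ + 4))),
    fun x hx q _ hqx hbox n _ χ y hqn hn hy1 hy2 ↦ ?_⟩
  have hx₀ : x₀ ≤ x := (le_max_left _ _).trans hx
  have hn16 := modulus_le hκ ((le_max_right _ _).trans hx) hqx hn
  exact h x hx₀ n hn16 χ (fun z h1 h2 h3 ↦ hbox n χ z hqn hn h1 h2 h3) y hy1 hy2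

end Summit.Parity.GeneralizedHardyLittlewood.Theorems.DilatedTableChowla.OnePointTransfer
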